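import Summits.QuantumFields.BalabanUV.Beta.D1BFx.LandauMultiplierMean
import Literature.MathematicalPhysics.QuantumFieldTheory.Balaban1983to89.Beta.AffineReproduction
import Literature.MathematicalPhysics.QuantumFieldTheory.Balaban1983to89.Beta.AveragingContours

/-!
# Road BF-x, slot (K) dictionary brick B3 (G-P): `Δ₀ ∘ P` IS BLOCK-CONSTANT ON THE LEFT — the Laplacian row against the `U = 1` gauge-term
# projector `P = G′Q′*(Q′G′²Q′*)⁻¹Q′G′` depends on the fine site only through its block, at matrix level (pv23 currency) and for the 0-form
# operator `g ↦ Σ'_q P(·,q) g(q)` on bounded `g` (road currency), with the `IsBlockConst`∕`codiff₁ ∘ dz` reading and its vocabulary bridges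

HONEST DEPENDENCY (page 1, mandatory): continuum YM on T⁴ ⇐ BetaPertH ∧ nine spine estimates (0/9 proved); BetaPertH ⇐ (D1) ∧ (D4) ∧
CAP+tail; G-an2-4 gates asym, D1 and NE2/3/4.  HONEST FRAMING (cell contract, verbatim): «discharging `BetaPertH` makes Bałaban's UV
stability UNCONDITIONAL — a real constructive-QFT result; it is NOT the continuum limit and NOT the Clay problem.»  THIS MODULE is [folklore]
lattice bookkeeping about the CELL'S OWN typed objects (pv23's `Pker`∕road `Pgt`, `kerP`, `lapKer`, `AX`; an2's `codiff₁`, `dz`, `IsBlockConst`),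
composed BY NAME from `RProjector.sum_AX_mul_Pker` (the Euler–Lagrange identity `Δ′_a·P = (n+1)^{−d}·Q′*C Q′G′`), `LandauMultiplierMean.spr_Pgt`,
`GhostLeg.blk_pred_apply`∕`cast_pred_add_one` and `B5Hk103ScalarZd.tsum_lapKer_mul`; no `def`, no `def … : Prop`, nothing cited, 0 sorry.  It is
brick B3 of the road owner's claim table `HOME/b2b-balaban-beta-d1-p2/DICT-BRICKS.md` (the (gauge) step of B6∕B7: `Δ₀PδA ∈ BC`); it asserts NO
line of the dictionary (D-H)∕(D-Γ).  0∕4 binders of row D1 (hW, hR, D1Tel, D1Rep) discharged; NOT D1, NOT BetaPertH, NOT continuum, NOT Clay.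

ABSOLUTE RULE (cell charter, verbatim): «No internally-minted statement may enter as a cited fact. Every hypothesis is either kernel-proved
in this package or a verbatim quotation of a PUBLISHED theorem with page reference. The manuscript(s) under audit are NOT citable for their
own disputed steps — they are the thing under adjudication; programme-internal (2001/route/tribunal) claims are never citable.»

WHY (K-R1-SPEC v2 §2 (D-H)∕(D-Γ), gauge condition (G) of `KKTFluctuationUnique.SolvesKKT`: `Δ₀ δA ∈ BC`).  For the R-weighted candidates
`A = ℋ_R c`, `A = Γ_R v` the codifferential splits as `Δ₀δA = Δ₀RδA + Δ₀PδA`; the `R`-part is handled by the tower equation (brick B5) and the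
`P`-part must be BLOCK-CONSTANT — which is what `Δ′_a·P = (n+1)^{−d}·Q′*C Q′G′` says once the `aQ′*Q′` part of `Δ′_a` (block-constant on the left
by itself) is split off: `(n+1)²·Σ_r (−Δ)(p,r)P(r,q) = (n+1)^{−d}(G′Q′*C)(q, blk p) − a(n+1)^{−d}·Σ_{r ∈ B(blk p)} P(r,q)`.

CONTENT.
* §1 MATRIX LEVEL (pv23 currency: any `d`, block side `m + 1`, `0 < a`): `sum_sameBlk_mul_Pker`; **`sum_lapKer_mul_Pker`** (the displayed
  formula); **`sum_lapKer_mul_Pker_eq_of_blk_eq`** (depends on `p` only through `blk m p`); `tsum_lapKer_mul_Pker`.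
* §2 OPERATOR LEVEL (road currency `d = 4`, block side `n ≥ 1`, `Pgt n a = Pker (n−1) a`; bounded `g`): `summable_Pgt_mul`; **`sum_lapKer_mul_tsum_Pgt`**
  (the finite Laplacian row passes inside the `P`-series); **`sum_lapKer_mul_tsum_Pgt_eq`** (explicit value, block-constant in `p`);
  **`sum_lapKer_mul_tsum_Pgt_eq_of_blk_eq`**.
* §3 BRIDGES + THE `IsBlockConst` READING: `blk_pred_eq_blk` (`B6QGQLower276.blk (n−1) = AveragingContours.blk n`), **`isBlockConst_iff_blk`**
  (`IsBlockConst n g ↔ ∀ p p′, blk n p = blk n p′ → g p = g p′`), `codiff₁_dz_eq_sum_nbhd` (`codiff₁ (dz f) p = Σ_{r ∈ nbhd m p} lapKer p r · f r`,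
  three-point form `tsum_lapKer_mul`), and **`isBlockConst_codiff₁_dz_Pf`**: for bounded `g`,
  `IsBlockConst n (codiff₁ (dz (fun p ↦ Σ'_q Pgt n a p q () () · g q)))` — BRICK B3 AS TABLED.
Unit `b2b-balaban-beta-d1-formalise-leaf-06` (gen 6), 2026-08-20; claim `CLAIM «DICT-B3»` (journal); table `DICT-BRICKS.md` row B3.
-/

namespace Summit.QuantumFields.BalabanUV.Beta.D1BFx.ProjectorGaugeBlockConst

open Finset
open scoped BigOperators
open Literature.MathematicalPhysics.QuantumFieldTheory.Balaban1983to89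
open Literature.MathematicalPhysics.QuantumFieldTheory.Balaban1983to89.Beta
open B6QGQLower276 (X e B blk mem_B lapDir lapKer sameBlk AX)
open B5Hk103ScalarZd (nbhd lapKer_eq_zero_of_not_mem tsum_lapKer_mul)
open AffineAveraging (Form0 box toSite unitVec dz codiff₁)
open AffineReproduction (IsBlockConst)
open AveragingContours (off blk_block blk_add_off off_mem_box)
open Summit.QuantumFields.BalabanUV.Beta.TameKernelCalculus (Spr Tame Spr.tame)
open GhostLeg (blk_pred_apply cast_pred_add_one)
open RProjector (kerP Pker Pgt Pgt_apply sum_AX_mul_Pker)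
open LandauMultiplierMean (spr_Pgt)

noncomputable section

/-! ## §1 Matrix level: the Laplacian row against `P` (pv23 currency) -/

section Matrix

variable {d : ℕ}

/-- [folklore] The `Q′*Q′` row against `P` is the block sum over the block of `p`: `Σ_{r ∈ nbhd} 1[blk p = blk r]·P(r,q) = Σ_{r ∈ B(blk p)} P(r,q)`. -/
theorem sum_sameBlk_mul_Pker (m : ℕ) (a : ℝ) (p q : X d) :
    ∑ r ∈ nbhd m p, sameBlk m p r * Pker m a r q = ∑ r ∈ B m (blk m p), Pker m a r q := by
  classical
  have hsub : B m (blk m p) ⊆ nbhd m p := fun r hr => by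
    simp only [nbhd, Finset.mem_union]
    exact Or.inl (Or.inl hr)
  rw [← Finset.sum_subset hsub (fun r _ hr => by rw [sameBlk, if_neg (fun h => hr (mem_B.2 h.symm)), zero_mul])]
  exact Finset.sum_congr rfl fun r hr => by rw [sameBlk, if_pos (mem_B.1 hr).symm, one_mul]

/-- [folklore] **THE LAPLACIAN ROW AGAINST `P`, EXPLICIT AND BLOCK-CONSTANT IN `p`**:
`Σ_{r ∈ nbhd m p} (−Δ)(p,r)·P(r,q) = (m+1)⁻²·((m+1)^{−d}·(G′Q′*C)(q, blk p) − a(m+1)^{−d}·Σ_{r ∈ B(blk p)} P(r,q))`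
(`RProjector.sum_AX_mul_Pker` with the `aQ′*Q′` part of `Δ′_a` split off). -/
theorem sum_lapKer_mul_Pker (m : ℕ) {a : ℝ} (ha : 0 < a) (p q : X d) :
    ∑ r ∈ nbhd m p, lapKer p r * Pker m a r q =
      (((m : ℝ) + 1) ^ 2)⁻¹ * ((((m : ℝ) + 1) ^ d)⁻¹ * kerP m a q (blk m p)
        - a / ((m : ℝ) + 1) ^ d * ∑ r ∈ B m (blk m p), Pker m a r q) := by
  have hA := sum_AX_mul_Pker m ha p q
  have e : ∀ r ∈ nbhd m p, AX m a p r * Pker m a r q =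
      ((m : ℝ) + 1) ^ 2 * (lapKer p r * Pker m a r q) + a / ((m : ℝ) + 1) ^ d * (sameBlk m p r * Pker m a r q) := by
    intro r _
    rw [AX]
    ring
  rw [Finset.sum_congr rfl e, Finset.sum_add_distrib, ← Finset.mul_sum, ← Finset.mul_sum, sum_sameBlk_mul_Pker] at hA
  have hm : (((m : ℝ) + 1) ^ 2) ≠ 0 := by positivity
  have hL : ((m : ℝ) + 1) ^ 2 * ∑ r ∈ nbhd m p, lapKer p r * Pker m a r q =
      (((m : ℝ) + 1) ^ d)⁻¹ * kerP m a q (blk m p) - a / ((m : ℝ) + 1) ^ d * ∑ r ∈ B m (blk m p), Pker m a r q := by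
    linarith
  calc ∑ r ∈ nbhd m p, lapKer p r * Pker m a r q
      = (((m : ℝ) + 1) ^ 2)⁻¹ * (((m : ℝ) + 1) ^ 2 * ∑ r ∈ nbhd m p, lapKer p r * Pker m a r q) := by
        rw [inv_mul_cancel_left₀ hm]
    _ = _ := by rw [hL]

/-- [folklore] **`Δ₀ ∘ P` IS BLOCK-CONSTANT ON THE LEFT (matrix level)**: the Laplacian row against `P` at `p` equals the one at `p′` whenever
`blk m p = blk m p′`. -/
theorem sum_lapKer_mul_Pker_eq_of_blk_eq (m : ℕ) {a : ℝ} (ha : 0 < a) {p p' : X d} (h : blk m p = blk m p') (q : X d) :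
    ∑ r ∈ nbhd m p, lapKer p r * Pker m a r q = ∑ r ∈ nbhd m p', lapKer p' r * Pker m a r q := by
  rw [sum_lapKer_mul_Pker m ha, sum_lapKer_mul_Pker m ha, h]

/-- [folklore] Series form of the Laplacian row against `P` (the row of `−Δ` at `p` is carried by `nbhd m p`). -/
theorem tsum_lapKer_mul_Pker (m : ℕ) (a : ℝ) (p q : X d) :
    ∑' r : X d, lapKer p r * Pker m a r q = ∑ r ∈ nbhd m p, lapKer p r * Pker m a r q :=
  tsum_eq_sum (s := nbhd m p) (fun r hr => by rw [lapKer_eq_zero_of_not_mem hr, zero_mul])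

end Matrix

/-! ## §2 Operator level: `Δ₀ (P g)` for bounded `g` (road currency `d = 4`, block side `n`) -/

section Operator

variable (n : ℕ) [NeZero n] (a : ℝ)

/-- [folklore] For bounded `g` the `P`-series `q ↦ P(p,q)·g(q)` is summable (`P` decays: `LandauMultiplierMean.spr_Pgt`). -/
theorem summable_Pgt_mul (ha : 0 < a) {g : X 4 → ℝ} {M : ℝ} (hg : ∀ q, |g q| ≤ M) (p : X 4) :
    Summable fun q : X 4 => Pgt n a p q () () * g q := by
  obtain ⟨hrow, -, -⟩ := (spr_Pgt n a ha).tame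
  obtain ⟨φ, hφ, hφ0, hφb⟩ := hrow p
  refine Summable.of_norm_bounded (hφ.mul_right M) fun q => ?_
  rw [Real.norm_eq_abs, abs_mul]
  exact mul_le_mul (hφb q () ()) (hg q) (abs_nonneg _) (hφ0 q)

/-- [folklore] **THE FINITE LAPLACIAN ROW PASSES INSIDE THE `P`-SERIES**:
`Σ_{r ∈ nbhd} (−Δ)(p,r)·(Σ'_q P(r,q) g q) = Σ'_q (Σ_{r ∈ nbhd} (−Δ)(p,r)P(r,q))·g q`. -/
theorem sum_lapKer_mul_tsum_Pgt (ha : 0 < a) {g : X 4 → ℝ} {M : ℝ} (hg : ∀ q, |g q| ≤ M) (p : X 4) :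
    ∑ r ∈ nbhd (n - 1) p, lapKer p r * (∑' q : X 4, Pgt n a r q () () * g q) =
      ∑' q : X 4, (∑ r ∈ nbhd (n - 1) p, lapKer p r * Pgt n a r q () ()) * g q := by
  have hs : ∀ r ∈ nbhd (n - 1) p, Summable fun q : X 4 => lapKer p r * (Pgt n a r q () () * g q) :=
    fun r _ => (summable_Pgt_mul n a ha hg r).mul_left _
  calc ∑ r ∈ nbhd (n - 1) p, lapKer p r * (∑' q : X 4, Pgt n a r q () () * g q)
      = ∑ r ∈ nbhd (n - 1) p, ∑' q : X 4, lapKer p r * (Pgt n a r q () () * g q) :=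
        Finset.sum_congr rfl fun r _ => (tsum_mul_left).symm
    _ = ∑' q : X 4, ∑ r ∈ nbhd (n - 1) p, lapKer p r * (Pgt n a r q () () * g q) := (Summable.tsum_finsetSum hs).symm
    _ = ∑' q : X 4, (∑ r ∈ nbhd (n - 1) p, lapKer p r * Pgt n a r q () ()) * g q := by
        refine tsum_congr fun q => ?_
        rw [Finset.sum_mul]
        exact Finset.sum_congr rfl fun r _ => by ring

/-- [folklore] **EXPLICIT VALUE OF `Δ₀ (P g)` IN ROAD UNITS** (block side `n`, `(n−1)+1 = n`):
`Σ_{r ∈ nbhd} (−Δ)(p,r)·(Pg)(r) = Σ'_q n⁻²·(n⁻⁴·(G′Q′*C)(q, blk p) − a·n⁻⁴·Σ_{r ∈ B(blk p)} P(r,q))·g q` — a function of `blk (n−1) p` alone. -/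
theorem sum_lapKer_mul_tsum_Pgt_eq (ha : 0 < a) {g : X 4 → ℝ} {M : ℝ} (hg : ∀ q, |g q| ≤ M) (p : X 4) :
    ∑ r ∈ nbhd (n - 1) p, lapKer p r * (∑' q : X 4, Pgt n a r q () () * g q) =
      ∑' q : X 4, (((n : ℝ) ^ 2)⁻¹ * ((((n : ℝ)) ^ 4)⁻¹ * kerP (n - 1) a q (blk (n - 1) p)
        - a / (n : ℝ) ^ 4 * ∑ r ∈ B (n - 1) (blk (n - 1) p), Pker (n - 1) a r q)) * g q := by
  rw [sum_lapKer_mul_tsum_Pgt n a ha hg p]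
  refine tsum_congr fun q => ?_
  simp only [Pgt_apply]
  rw [sum_lapKer_mul_Pker (n - 1) ha p q, cast_pred_add_one n]

/-- [folklore] **`Δ₀ ∘ P` IS BLOCK-CONSTANT ON THE LEFT (operator level)**: for bounded `g`, the Laplacian row of `P g` at `p` equals the one at
`p′` whenever `blk (n−1) p = blk (n−1) p′`. -/
theorem sum_lapKer_mul_tsum_Pgt_eq_of_blk_eq (ha : 0 < a) {g : X 4 → ℝ} {M : ℝ} (hg : ∀ q, |g q| ≤ M) {p p' : X 4}
    (h : blk (n - 1) p = blk (n - 1) p') :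
    ∑ r ∈ nbhd (n - 1) p, lapKer p r * (∑' q : X 4, Pgt n a r q () () * g q) =
      ∑ r ∈ nbhd (n - 1) p', lapKer p' r * (∑' q : X 4, Pgt n a r q () () * g q) := by
  rw [sum_lapKer_mul_tsum_Pgt_eq n a ha hg p, sum_lapKer_mul_tsum_Pgt_eq n a ha hg p', h]

end Operator

/-! ## §3 Vocabulary bridges and the `IsBlockConst` ∕ `codiff₁ ∘ dz` reading -/

section Bridges

variable (n : ℕ) [NeZero n]

/-- [folklore] **BLOCK LABELS AGREE**: pv23's `blk (n−1)` (block side `(n−1)+1`) IS an2's `AveragingContours.blk n` (floor division by `n`). -/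
theorem blk_pred_eq_blk (p : X 4) : blk (n - 1) p = AveragingContours.blk n p := by
  funext μ
  rw [blk_pred_apply]
  rfl

/-- [folklore] The zero offset is in the box (`n ≥ 1`). -/
theorem zero_mem_box : (fun _ : Fin 4 => (0 : ℕ)) ∈ box 4 n :=
  Fintype.mem_piFinset.2 fun _ => Finset.mem_range.2 (NeZero.pos n)

omit [NeZero n] in
/-- [folklore] `N•y + toSite 0 = N•y`. -/
theorem zsmul_add_toSite_zero (y : X 4) : (n : ℤ) • y + toSite (fun _ : Fin 4 => (0 : ℕ)) = (n : ℤ) • y := by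
  rw [AveragingContours.toSite_zero, add_zero]

/-- [folklore] **`IsBlockConst` ⟺ «depends on the site only through its block label»** (`n ≥ 1`). -/
theorem isBlockConst_iff_blk (g : X 4 → ℝ) :
    IsBlockConst n g ↔ ∀ p p' : X 4, AveragingContours.blk n p = AveragingContours.blk n p' → g p = g p' := by
  have hn : 1 ≤ n := NeZero.one_le
  constructor
  · intro hI p p' h
    have hp : g p = g ((n : ℤ) • AveragingContours.blk n p) := by
      conv_lhs => rw [← blk_add_off hn p]
      exact hI _ _ (off_mem_box hn p)
    have hp' : g p' = g ((n : ℤ) • AveragingContours.blk n p') := by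
      conv_lhs => rw [← blk_add_off hn p']
      exact hI _ _ (off_mem_box hn p')
    rw [hp, hp', h]
  · intro H y b hb
    apply H
    rw [blk_block y hb]
    conv_rhs => rw [← zsmul_add_toSite_zero n y]
    rw [blk_block y (zero_mem_box n)]

/-- [folklore] A function of the pv23 block label alone is `IsBlockConst`. -/
theorem isBlockConst_of_blk_pred {g : X 4 → ℝ} (H : ∀ p p' : X 4, blk (n - 1) p = blk (n - 1) p' → g p = g p') :
    IsBlockConst n g :=
  (isBlockConst_iff_blk n g).2 fun p p' h => H p p' (by rw [blk_pred_eq_blk, blk_pred_eq_blk, h])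

/-- [folklore] **`codiff₁ ∘ dz` IS THE LAPLACIAN ROW** (an2's stencils vs pv23's kernel; `e μ = unitVec μ` definitionally): for EVERY `f` and
every window parameter `m`, `codiff₁ (dz f) p = Σ_{r ∈ nbhd m p} (−Δ)(p,r)·f r` (three-point form `B5Hk103ScalarZd.tsum_lapKer_mul`). -/
theorem codiff₁_dz_eq_sum_nbhd (m : ℕ) (f : X 4 → ℝ) (p : X 4) :
    codiff₁ (dz f) p = ∑ r ∈ nbhd m p, lapKer p r * f r := by
  have h3 := tsum_lapKer_mul p f
  rw [tsum_eq_sum (s := nbhd m p) (fun r hr => by rw [lapKer_eq_zero_of_not_mem hr, zero_mul])] at h3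
  rw [h3]
  simp only [AffineAveraging.codiff₁, AffineAveraging.dz]
  refine Finset.sum_congr rfl fun μ _ => ?_
  rw [show AffineAveraging.unitVec μ = e μ from rfl, sub_add_cancel]
  ring

/-- [folklore] **BRICK B3 (G-P): `Δ₀ ∘ P` IS BLOCK-CONSTANT ON THE LEFT** — for every bounded fine function `g`, the 0-form
`codiff₁ (dz (p ↦ Σ'_q P(p,q)·g q))` is block-constant (`IsBlockConst n`), `P = Pgt n a` the `U = 1` gauge-term projector of B9 (3.25). -/
theorem isBlockConst_codiff₁_dz_Pf (a : ℝ) (ha : 0 < a) {g : X 4 → ℝ} {M : ℝ} (hg : ∀ q, |g q| ≤ M) :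
    IsBlockConst n (codiff₁ (dz (fun p => ∑' q : X 4, Pgt n a p q () () * g q))) := by
  refine isBlockConst_of_blk_pred n fun p p' h => ?_
  rw [codiff₁_dz_eq_sum_nbhd (n - 1), codiff₁_dz_eq_sum_nbhd (n - 1)]
  exact sum_lapKer_mul_tsum_Pgt_eq_of_blk_eq n a ha hg h

/-- [folklore] The same in the «equal block labels» currency (no `IsBlockConst`). -/
theorem codiff₁_dz_Pf_eq_of_blk_eq (a : ℝ) (ha : 0 < a) {g : X 4 → ℝ} {M : ℝ} (hg : ∀ q, |g q| ≤ M) {p p' : X 4}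
    (h : AveragingContours.blk n p = AveragingContours.blk n p') :
    codiff₁ (dz (fun p => ∑' q : X 4, Pgt n a p q () () * g q)) p = codiff₁ (dz (fun p => ∑' q : X 4, Pgt n a p q () () * g q)) p' :=
  (isBlockConst_iff_blk n _).1 (isBlockConst_codiff₁_dz_Pf n a ha hg) p p' h

end Bridges

end

end Summit.QuantumFields.BalabanUV.Beta.D1BFx.ProjectorGaugeBlockConst
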